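import Summits.SmoothPoincare4.SmoothPoincare4.Theorems.CongruenceShadowsNormalFormStablyTrivialLuftDefs

/-!
# Stub `stub_freePadding` of line `luft-twist-reduction` for crux `NormalFormStablyTrivial`
# (item stmt-SmoothPoincare4-14591, route `CongruenceShadows`) — auxiliary file 1: the move algebra

The padding moves of `F_n = FreeGroup (Fin n)` (`paddingGens n`, `…LuftDefs.lean` §3) are the right
transvections `xᵢ ↦ xᵢ x_t` BY a trivial letter (`t ≢ 0 (mod 3)`) and the partial conjugations
`x_t ↦ x_j⁻¹ x_t x_j` OF a trivial letter.  This file proves that the subgroup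
`E = Subgroup.closure (paddingGens n)` they generate contains the composite moves used by the
stable padding lemma (`FreePadding`, TRIAGE-r1-2 App. A of the crux):

* `exists_partialConj_word` — `x_s ↦ w⁻¹ x_s w` for a trivial letter `x_s` and ANY word `w`
  avoiding `x_s` (partial conjugations compose: `κ_{s,ww'} = κ_{s,w} κ_{s,w'}`);
* `exists_transvection_mul/inv/conj` — right transvections `R_{s,u} : x_s ↦ x_s u` (`u` avoiding
  `x_s`) multiply in `u`, and `R_{s,wuw⁻¹} = κ_{s,w} R_{s,u} κ_{s,w}⁻¹`;
* `exists_transvection_of_mem_closure` — `R_{s,u} ∈ E` for every word `u` in trivial letters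
  other than `x_s` (`x_s` arbitrary);
* `exists_transvection_of_mem_normalClosure` — `R_{s,f h} ∈ E` for a trivial letter `x_s` and
  every `h` in the normal closure of a set of letters mapped by a homomorphism `f` to trivial
  letters, all of `f` avoiding `x_s` (used with `f` = the level inclusion);
* `helper_freePadding_1` (registered helper) — SWEEP: independent transvections of the letters of
  a finite set `L` by words in letters of a set `C` disjoint from `L` assemble to one element of
  `E` (induction on `L`).

All statements are existential (`∃ ρ ∈ E, ρ x_s = … ∧ ∀ i ≠ s, ρ xᵢ = xᵢ`): an automorphism of a
free group is determined by its values on the basis, so no normal form of the moves is needed.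
Conventions: `MulAut` multiplication is composition, `(φ * ψ) x = φ (ψ x)`.
-/

-- the prescribed namespace `Summit.<P>.<Sub>.…` duplicates `SmoothPoincare4` (P = Sub)
set_option linter.dupNamespace false

noncomputable section

namespace Summit.SmoothPoincare4.SmoothPoincare4.Theorems.NormalFormStablyTrivial.Luft

open Literature.GroupTheory.CombinatorialGroupTheory

variable {n : ℕ}

/-- An automorphism of `F_n` fixing the letters indexed by `S` fixes the subgroup they generate. -/
theorem apply_eq_self_of_mem_closure {ρ : MulAut (FreeGroup (Fin n))} {S : Set (Fin n)}
    (h : ∀ i ∈ S, ρ (FreeGroup.of i) = FreeGroup.of i) {w : FreeGroup (Fin n)}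
    (hw : w ∈ Subgroup.closure (FreeGroup.of '' S)) : ρ w = w := by
  refine (Subgroup.closure_le (ρ.toMonoidHom.eqLocus (MonoidHom.id _))).2 ?_ hw
  rintro _ ⟨i, hi, rfl⟩
  exact h i hi

/-- The identity is the trivial right transvection `x_s ↦ x_s · 1`. -/
theorem exists_transvection_one (s : Fin n) :
    ∃ ρ ∈ Subgroup.closure (paddingGens n), ρ (FreeGroup.of s) = FreeGroup.of s * 1 ∧
      ∀ i, i ≠ s → ρ (FreeGroup.of i) = FreeGroup.of i :=
  ⟨1, one_mem _, by rw [MulAut.one_apply, mul_one], fun _ _ => rfl⟩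

/-- The elementary right transvection `x_s ↦ x_s x_t` by a trivial letter `x_t` is a padding
move. -/
theorem exists_transvection_of {s t : Fin n} (hst : s ≠ t) (ht : (t : ℕ) % 3 ≠ 0) :
    ∃ ρ ∈ Subgroup.closure (paddingGens n),
      ρ (FreeGroup.of s) = FreeGroup.of s * FreeGroup.of t ∧
        ∀ i, i ≠ s → ρ (FreeGroup.of i) = FreeGroup.of i :=
  ⟨nielsenBeta s t hst, Subgroup.subset_closure (nielsenBeta_mem_paddingGens hst ht),
    nielsenBeta_of_self hst, fun _ hi => nielsenBeta_of_ne hst hi⟩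

/-- **Right transvections multiply**: if `x_s ↦ x_s u₁` and `x_s ↦ x_s u₂` (other letters fixed)
are products of padding moves and `u₂` avoids `x_s`, then so is `x_s ↦ x_s u₁ u₂`
(`R_{s,u₁u₂} = R_{s,u₁} ∘ R_{s,u₂}`). -/
theorem exists_transvection_mul {s : Fin n} {u₁ u₂ : FreeGroup (Fin n)}
    (h₁ : ∃ ρ ∈ Subgroup.closure (paddingGens n), ρ (FreeGroup.of s) = FreeGroup.of s * u₁ ∧
      ∀ i, i ≠ s → ρ (FreeGroup.of i) = FreeGroup.of i)
    (h₂ : ∃ ρ ∈ Subgroup.closure (paddingGens n), ρ (FreeGroup.of s) = FreeGroup.of s * u₂ ∧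
      ∀ i, i ≠ s → ρ (FreeGroup.of i) = FreeGroup.of i)
    (hu₂ : u₂ ∈ Subgroup.closure (FreeGroup.of '' {i | i ≠ s})) :
    ∃ ρ ∈ Subgroup.closure (paddingGens n), ρ (FreeGroup.of s) = FreeGroup.of s * (u₁ * u₂) ∧
      ∀ i, i ≠ s → ρ (FreeGroup.of i) = FreeGroup.of i := by
  obtain ⟨ρ₁, h₁m, h₁s, h₁i⟩ := h₁
  obtain ⟨ρ₂, h₂m, h₂s, h₂i⟩ := h₂
  refine ⟨ρ₁ * ρ₂, mul_mem h₁m h₂m, ?_, fun i hi => ?_⟩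
  · rw [MulAut.mul_apply, h₂s, map_mul, h₁s, apply_eq_self_of_mem_closure h₁i hu₂, mul_assoc]
  · rw [MulAut.mul_apply, h₂i i hi, h₁i i hi]

/-- **Right transvections invert**: if `x_s ↦ x_s u` (other letters fixed) is a product of padding
moves and `u` avoids `x_s`, then so is `x_s ↦ x_s u⁻¹` (its inverse). -/
theorem exists_transvection_inv {s : Fin n} {u : FreeGroup (Fin n)}
    (h : ∃ ρ ∈ Subgroup.closure (paddingGens n), ρ (FreeGroup.of s) = FreeGroup.of s * u ∧
      ∀ i, i ≠ s → ρ (FreeGroup.of i) = FreeGroup.of i)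
    (hu : u ∈ Subgroup.closure (FreeGroup.of '' {i | i ≠ s})) :
    ∃ ρ ∈ Subgroup.closure (paddingGens n), ρ (FreeGroup.of s) = FreeGroup.of s * u⁻¹ ∧
      ∀ i, i ≠ s → ρ (FreeGroup.of i) = FreeGroup.of i := by
  obtain ⟨ρ, hm, hs, hi⟩ := h
  refine ⟨ρ⁻¹, inv_mem hm, ?_, fun i hne => ?_⟩
  · rw [MulAut.inv_apply, MulEquiv.symm_apply_eq, map_mul, map_inv, hs,
      apply_eq_self_of_mem_closure hi hu, mul_inv_cancel_right]
  · rw [MulAut.inv_apply, MulEquiv.symm_apply_eq, hi i hne]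

/-- **Partial conjugations compose**: for a trivial letter `x_s` (`s ≢ 0 (mod 3)`) and every word
`w` avoiding `x_s`, the automorphism `x_s ↦ w⁻¹ x_s w` (other letters fixed) is a product of
padding moves (`κ_{s,ww'} = κ_{s,w} ∘ κ_{s,w'}`, `κ_{s,x_j} = partialConj s j`). -/
theorem exists_partialConj_word {s : Fin n} (hs : (s : ℕ) % 3 ≠ 0) {w : FreeGroup (Fin n)}
    (hw : w ∈ Subgroup.closure (FreeGroup.of '' {i | i ≠ s})) :
    ∃ κ ∈ Subgroup.closure (paddingGens n),
      κ (FreeGroup.of s) = w⁻¹ * FreeGroup.of s * w ∧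
        ∀ i, i ≠ s → κ (FreeGroup.of i) = FreeGroup.of i := by
  induction hw using Subgroup.closure_induction with
  | mem x hx =>
    obtain ⟨j, hj, rfl⟩ := hx
    exact ⟨partialConj s j (fun h => hj h.symm),
      Subgroup.subset_closure (partialConj_mem_paddingGens _ hs), partialConj_of_self _,
      fun i hi => partialConj_of_ne _ hi⟩
  | one =>
    exact ⟨1, one_mem _, by rw [MulAut.one_apply, inv_one, one_mul, mul_one], fun _ _ => rfl⟩
  | mul x y _ hy ihx ihy =>
    obtain ⟨κ₁, h₁m, h₁s, h₁i⟩ := ihx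
    obtain ⟨κ₂, h₂m, h₂s, h₂i⟩ := ihy
    refine ⟨κ₁ * κ₂, mul_mem h₁m h₂m, ?_, fun i hi => ?_⟩
    · rw [MulAut.mul_apply, h₂s]
      simp only [map_mul, map_inv, h₁s, apply_eq_self_of_mem_closure h₁i hy]
      group
    · rw [MulAut.mul_apply, h₂i i hi, h₁i i hi]
  | inv x hx ih =>
    obtain ⟨κ, hm, hs', hi⟩ := ih
    refine ⟨κ⁻¹, inv_mem hm, ?_, fun i hne => ?_⟩
    · rw [MulAut.inv_apply, MulEquiv.symm_apply_eq]
      simp only [map_mul, map_inv, hs', apply_eq_self_of_mem_closure hi hx]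
      group
    · rw [MulAut.inv_apply, MulEquiv.symm_apply_eq, hi i hne]

/-- **Conjugating a transvection**: if `x_s ↦ x_s u` is a product of padding moves (`x_s` a
trivial letter, `u` avoiding `x_s`), then so is `x_s ↦ x_s (w u w⁻¹)` for every word `w` avoiding
`x_s`: `R_{s,wuw⁻¹} = κ_{s,w} ∘ R_{s,u} ∘ κ_{s,w}⁻¹`. -/
theorem exists_transvection_conj {s : Fin n} (hs : (s : ℕ) % 3 ≠ 0) {u w : FreeGroup (Fin n)}
    (h : ∃ ρ ∈ Subgroup.closure (paddingGens n), ρ (FreeGroup.of s) = FreeGroup.of s * u ∧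
      ∀ i, i ≠ s → ρ (FreeGroup.of i) = FreeGroup.of i)
    (hu : u ∈ Subgroup.closure (FreeGroup.of '' {i | i ≠ s}))
    (hw : w ∈ Subgroup.closure (FreeGroup.of '' {i | i ≠ s})) :
    ∃ ρ ∈ Subgroup.closure (paddingGens n),
      ρ (FreeGroup.of s) = FreeGroup.of s * (w * u * w⁻¹) ∧
        ∀ i, i ≠ s → ρ (FreeGroup.of i) = FreeGroup.of i := by
  obtain ⟨ρ, hm, hρs, hρi⟩ := h
  obtain ⟨κ, hκm, hκs, hκi⟩ := exists_partialConj_word hs hw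
  have hκ' : κ⁻¹ (FreeGroup.of s) = w * FreeGroup.of s * w⁻¹ := by
    rw [MulAut.inv_apply, MulEquiv.symm_apply_eq]
    simp only [map_mul, map_inv, hκs, apply_eq_self_of_mem_closure hκi hw]
    group
  have hκ'i : ∀ i, i ≠ s → κ⁻¹ (FreeGroup.of i) = FreeGroup.of i := fun i hi => by
    rw [MulAut.inv_apply, MulEquiv.symm_apply_eq, hκi i hi]
  refine ⟨κ * ρ * κ⁻¹, mul_mem (mul_mem hκm hm) (inv_mem hκm), ?_, fun i hi => ?_⟩
  · rw [MulAut.mul_apply, MulAut.mul_apply, hκ']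
    simp only [map_mul, map_inv, hρs, hκs, apply_eq_self_of_mem_closure hρi hw,
      apply_eq_self_of_mem_closure hκi hw, apply_eq_self_of_mem_closure hκi hu]
    group
  · rw [MulAut.mul_apply, MulAut.mul_apply, hκ'i i hi, hρi i hi, hκi i hi]

/-- **Right transvections by words in trivial letters**: for every letter `x_s` and every word
`u` in trivial letters other than `x_s`, the transvection `x_s ↦ x_s u` (other letters fixed) is
a product of padding moves. -/
theorem exists_transvection_of_mem_closure {s : Fin n} {S : Set (Fin n)} (hsS : s ∉ S)
    (hS : ∀ t ∈ S, (t : ℕ) % 3 ≠ 0) {u : FreeGroup (Fin n)}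
    (hu : u ∈ Subgroup.closure (FreeGroup.of '' S)) :
    ∃ ρ ∈ Subgroup.closure (paddingGens n), ρ (FreeGroup.of s) = FreeGroup.of s * u ∧
      ∀ i, i ≠ s → ρ (FreeGroup.of i) = FreeGroup.of i := by
  have hSs : FreeGroup.of '' S ⊆ FreeGroup.of '' {i | i ≠ s} :=
    Set.image_mono fun t ht h => hsS (h ▸ ht)
  induction hu using Subgroup.closure_induction with
  | mem x hx =>
    obtain ⟨t, ht, rfl⟩ := hx
    exact exists_transvection_of (fun h => hsS (h ▸ ht)) (hS t ht)
  | one => exact exists_transvection_one s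
  | mul x y _ hy ihx ihy =>
    exact exists_transvection_mul ihx ihy (Subgroup.closure_mono hSs hy)
  | inv x hx ih => exact exists_transvection_inv ih (Subgroup.closure_mono hSs hx)

/-- **Right transvections of a trivial letter by elements of a normal closure**: let `x_s` be a
trivial letter, `f : G →* F_n` a homomorphism all of whose values avoid `x_s`, and `T ⊆ G` a set
mapped by `f` to trivial letters other than `x_s`.  Then for every `h` in the normal closure of
`T` the transvection `x_s ↦ x_s · f h` is a product of padding moves (normal closure = closure of
the conjugates; conjugates by `exists_transvection_conj`). -/
theorem exists_transvection_of_mem_normalClosure {G : Type*} [Group G] {s : Fin n}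
    (hs : (s : ℕ) % 3 ≠ 0) (f : G →* FreeGroup (Fin n))
    (hf : ∀ x, f x ∈ Subgroup.closure (FreeGroup.of '' {i | i ≠ s})) {T : Set G}
    (hT : ∀ t ∈ T, ∃ t' : Fin n, f t = FreeGroup.of t' ∧ t' ≠ s ∧ (t' : ℕ) % 3 ≠ 0)
    {h : G} (hh : h ∈ Subgroup.normalClosure T) :
    ∃ ρ ∈ Subgroup.closure (paddingGens n), ρ (FreeGroup.of s) = FreeGroup.of s * f h ∧
      ∀ i, i ≠ s → ρ (FreeGroup.of i) = FreeGroup.of i := by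
  unfold Subgroup.normalClosure at hh
  induction hh using Subgroup.closure_induction with
  | mem x hx =>
    obtain ⟨a, haT, hconj⟩ := Group.mem_conjugatesOfSet_iff.1 hx
    obtain ⟨c, rfl⟩ := isConj_iff.1 hconj
    obtain ⟨t', ht', ht's, ht'0⟩ := hT a haT
    rw [map_mul, map_mul, map_inv, ht']
    exact exists_transvection_conj hs (exists_transvection_of ht's.symm ht'0)
      (Subgroup.subset_closure ⟨t', ht's, rfl⟩) (hf c)
  | one => rw [map_one]; exact exists_transvection_one s
  | mul x y _ _ ihx ihy => rw [map_mul]; exact exists_transvection_mul ihx ihy (hf y)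
  | inv x _ ih => rw [map_inv]; exact exists_transvection_inv ih (hf x)

/-- **SWEEP (registered helper `helper_freePadding_1`)**: let `L` be a finite set of letters, `C`
a set of letters disjoint from `L`, and for every `s ∈ L` let `u s` be a word in the letters of
`C` such that `x_s ↦ x_s (u s)` (other letters fixed) is a product of padding moves.  Then ONE
product of padding moves `v` realises all these transvections at once: `v xᵢ = xᵢ` off `L` and
`v x_s = x_s (u s)` on `L` (induction on `L`; the moves do not interact because every `u s`
is fixed by all of them). -/
theorem helper_freePadding_1 : ∀ (n : ℕ) (L : Finset (Fin n)) (C : Set (Fin n)) (u : Fin n → FreeGroup (Fin n)), (∀ i ∈ C, i ∉ L) → (∀ s ∈ L, u s ∈ Subgroup.closure (FreeGroup.of '' C)) → (∀ s ∈ L, ∃ ρ ∈ Subgroup.closure (paddingGens n), ρ (FreeGroup.of s) = FreeGroup.of s * u s ∧ ∀ i, i ≠ s → ρ (FreeGroup.of i) = FreeGroup.of i) → ∃ v ∈ Subgroup.closure (paddingGens n), (∀ i, i ∉ L → v (FreeGroup.of i) = FreeGroup.of i) ∧ ∀ s ∈ L, v (FreeGroup.of s) = FreeGroup.of s * u s :=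 by
  intro n L
  induction L using Finset.induction_on with
  | empty =>
    intro C u _ _ _
    exact ⟨1, one_mem _, fun i _ => rfl, fun s hs => absurd hs (Finset.notMem_empty s)⟩
  | insert a L haL ih =>
    intro C u hCL hu hT
    obtain ⟨v', hv'm, hv'fix, hv'L⟩ := ih C u
      (fun i hi h => hCL i hi (Finset.mem_insert_of_mem h))
      (fun s hs => hu s (Finset.mem_insert_of_mem hs))
      (fun s hs => hT s (Finset.mem_insert_of_mem hs))
    obtain ⟨ρ, hρm, hρs, hρi⟩ := hT a (Finset.mem_insert_self a L)
    refine ⟨v' * ρ, mul_mem hv'm hρm, fun i hi => ?_, fun s hs => ?_⟩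
    · rw [Finset.mem_insert, not_or] at hi
      rw [MulAut.mul_apply, hρi i hi.1, hv'fix i hi.2]
    · rcases Finset.mem_insert.1 hs with rfl | hs'
      · rw [MulAut.mul_apply, hρs, map_mul, hv'fix _ haL,
          apply_eq_self_of_mem_closure
            (fun i hi => hv'fix i fun h => hCL i hi (Finset.mem_insert_of_mem h))
            (hu _ (Finset.mem_insert_self _ _))]
      · have hsa : s ≠ a := fun h => haL (h ▸ hs')
        rw [MulAut.mul_apply, hρi s hsa, hv'L s hs']

end Summit.SmoothPoincare4.SmoothPoincare4.Theorems.NormalFormStablyTrivial.Luft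

end
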